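import Mathlib
import Literature.Analysis.FluidPDE.Tao2016AveragedNS.RestartedCascadeFlows
import HarnessLib

/-!
# `GappedFrontRobust` / gap certificates: GAUSSIAN WEIGHTS satisfy the tail clauses (helper for item
  stmt-NavierStokesRegularity-20423 and the certificate format v2 of routes TaoLadderRungThree /
  TaoLadderRungTwo / TaoLadderRungTwoPoly)

HONEST FRAMING: elementary real-number inequalities about the weight family
`w k = C · 2^{k²/2 + b k}` that the cell's certificate format (`TaoCascade.TailFat` / `TailCompat`, and
the thin-tail supplement H4b′) names as the intended design; nothing is asserted about any table or
flow, and nothing here concerns the Navier–Stokes equations. Purpose: the tribunal question "is the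
format satisfiable by the intended certificates?" (BC5 / T2) for the tail clauses.

* `gaussian_weight_T1` — for `0 ≤ ε₀ ≤ 1`, `b ≥ 1/2`, `C > 0`: `2 (1+ε₀)^k w k ≤ w (k+1)` for every
  `k ≥ 0` (clause (T1) of `TailFat` / `TailCompat`);
* `gaussian_weight_tailThin` — for `0 ≤ ε₀ ≤ 1`, `r ≥ 0`, `C > 0`, any `b`: the hand-over quantity is
  eventually below every threshold, `∀ ϑ > 0, ∃ k₂, ∀ k ≥ k₂, (1+ε₀)^{5(k+2)/2} r w(k+1) ≤ ϑ (w k)²`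
  (the thin-tail clause H4b′ spelled out; it implies the bounded form (H4b) of `TailCompat`).
-/

noncomputable section

-- the sub-problem namespace `Summit.NavierStokesRegularity.NavierStokesRegularity` repeats the summit name by design (D-0017)
set_option linter.dupNamespace false

namespace Summit.NavierStokesRegularity.NavierStokesRegularity.Theorems

open Set Literature.Analysis.FluidPDE Literature.Analysis.FluidPDE.TaoCascade

namespace GappedFrontRobust

/-- **(T1) for Gaussian weights**: with `w k = C · 2^{k²/2 + b k}`, `C > 0`, `b ≥ 1/2` and
`0 ≤ ε₀ ≤ 1`, `2 (1+ε₀)^k w k ≤ w (k+1)` for every shell `k ≥ 0`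
(`w(k+1)/w(k) = 2^{k + 1/2 + b} ≥ 2 · 2^k ≥ 2 (1+ε₀)^k`). [folklore] -/
theorem gaussian_weight_T1 {ε₀ C b : ℝ} (hε : 0 ≤ ε₀) (hε1 : ε₀ ≤ 1) (hC : 0 < C) (hb : 1 / 2 ≤ b)
    (w : ℤ → ℝ) (hw : ∀ k : ℤ, w k = C * (2 : ℝ) ^ ((k : ℝ) ^ 2 / 2 + b * k))
    (k : ℤ) (hk : 0 ≤ k) :
    2 * (1 + ε₀) ^ (k : ℝ) * w k ≤ w (k + 1) := by
  have hx : (0 : ℝ) ≤ k := by exact_mod_cast hk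
  have h2 : (0 : ℝ) < 2 := by norm_num
  rw [hw k, hw (k + 1)]
  push_cast
  -- exponent bookkeeping: ((k+1)^2/2 + b(k+1)) = (k^2/2 + bk) + (k + 1/2 + b)
  have hexp : ((k : ℝ) + 1) ^ 2 / 2 + b * ((k : ℝ) + 1) =
      ((k : ℝ) ^ 2 / 2 + b * k) + ((k : ℝ) + 1 / 2 + b) := by ring
  have hsplit : (2 : ℝ) ^ (((k : ℝ) ^ 2 / 2 + b * k) + ((k : ℝ) + 1 / 2 + b)) =
      (2 : ℝ) ^ ((k : ℝ) ^ 2 / 2 + b * k) * (2 : ℝ) ^ ((k : ℝ) + 1 / 2 + b) := Real.rpow_add h2 _ _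
  rw [hexp, hsplit]
  -- 2 (1+ε₀)^k ≤ 2^{k + 1/2 + b}
  have hq : (1 + ε₀) ^ (k : ℝ) ≤ (2 : ℝ) ^ (k : ℝ) :=
    Real.rpow_le_rpow (by linarith) (by linarith) hx
  have hpow : 2 * (2 : ℝ) ^ (k : ℝ) ≤ (2 : ℝ) ^ ((k : ℝ) + 1 / 2 + b) := by
    have : 2 * (2 : ℝ) ^ (k : ℝ) = (2 : ℝ) ^ ((k : ℝ) + 1) := by
      rw [Real.rpow_add h2, Real.rpow_one]; ring
    rw [this]
    exact Real.rpow_le_rpow_of_exponent_le (by norm_num) (by linarith)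
  have hw0 : 0 ≤ C * (2 : ℝ) ^ ((k : ℝ) ^ 2 / 2 + b * k) :=
    mul_nonneg hC.le (Real.rpow_pos_of_pos h2 _).le
  calc 2 * (1 + ε₀) ^ (k : ℝ) * (C * (2 : ℝ) ^ ((k : ℝ) ^ 2 / 2 + b * k))
      ≤ 2 * (2 : ℝ) ^ (k : ℝ) * (C * (2 : ℝ) ^ ((k : ℝ) ^ 2 / 2 + b * k)) := by
        gcongr
    _ ≤ (2 : ℝ) ^ ((k : ℝ) + 1 / 2 + b) * (C * (2 : ℝ) ^ ((k : ℝ) ^ 2 / 2 + b * k)) :=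
        mul_le_mul_of_nonneg_right hpow hw0
    _ = C * ((2 : ℝ) ^ ((k : ℝ) ^ 2 / 2 + b * k) * (2 : ℝ) ^ ((k : ℝ) + 1 / 2 + b)) := by ring

/-- **Thin tail (H4b′) for Gaussian weights**: with `w k = C · 2^{k²/2 + b k}`, `C > 0`, any real
`b`, `0 ≤ ε₀ ≤ 1` and `r ≥ 0`: for every `ϑ > 0` there is `k₂` with
`(1+ε₀)^{5(k+2)/2} · r · w(k+1) ≤ ϑ · (w k)²` for all `k ≥ k₂` (the quotient is
`(r/C) (1+ε₀)^{5(k+2)/2} 2^{-k²/2 + (1-b)k + 1/2 + b}`, super-geometrically small). [folklore] -/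
theorem gaussian_weight_tailThin {ε₀ r C b : ℝ} (hε : 0 ≤ ε₀) (hε1 : ε₀ ≤ 1) (hr : 0 ≤ r)
    (hC : 0 < C) (w : ℤ → ℝ) (hw : ∀ k : ℤ, w k = C * (2 : ℝ) ^ ((k : ℝ) ^ 2 / 2 + b * k)) :
    ∀ ϑ : ℝ, 0 < ϑ → ∃ k₂ : ℤ, ∀ k : ℤ, k₂ ≤ k →
      (1 + ε₀) ^ ((5 : ℝ) * (k + 2) / 2) * r * w (k + 1) ≤ ϑ * w k ^ 2 := by
  intro ϑ hϑ
  have h2 : (0 : ℝ) < 2 := by norm_num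
  -- choose n with (1/2)^n < ϑ C / (r + 1)
  have hhalf : (1 / 2 : ℝ) < 1 := by norm_num
  have hpos : 0 < ϑ * C / (r + 1) := div_pos (mul_pos hϑ hC) (by linarith)
  obtain ⟨n, hn⟩ := exists_pow_lt_of_lt_one hpos hhalf
  -- the exponent threshold: for x ≥ X₀, x²/2 + (b - 7/2) x - (11/2 + b) ≥ x
  set D : ℝ := |b - 7 / 2| + |11 / 2 + b| + 1 with hD
  have hD0 : 0 ≤ D := by positivity
  refine ⟨max (max n 1) ⌈2 * D + 2⌉, fun k hk => ?_⟩
  have hk1 : (1 : ℤ) ≤ k := le_trans (le_trans (le_max_right _ _) (le_max_left _ _)) hk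
  have hkn : (n : ℤ) ≤ k := le_trans (le_trans (le_max_left _ _) (le_max_left _ _)) hk
  have hkD : (⌈2 * D + 2⌉ : ℤ) ≤ k := le_trans (le_max_right _ _) hk
  set x : ℝ := (k : ℝ) with hxdef
  have hx1 : 1 ≤ x := by rw [hxdef]; exact_mod_cast hk1
  have hxD : 2 * D + 2 ≤ x := by
    have : ((⌈2 * D + 2⌉ : ℤ) : ℝ) ≤ x := by rw [hxdef]; exact_mod_cast hkD
    exact le_trans (Int.le_ceil _) this
  -- the two weights
  have hwk : w k = C * (2 : ℝ) ^ (x ^ 2 / 2 + b * x) := hw k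
  have hwk1 : w (k + 1) = C * (2 : ℝ) ^ ((x + 1) ^ 2 / 2 + b * (x + 1)) := by
    rw [hw (k + 1)]; push_cast; rfl
  -- exponents
  set E1 : ℝ := (5 : ℝ) * (x + 2) / 2 + ((x + 1) ^ 2 / 2 + b * (x + 1)) with hE1
  set E2 : ℝ := 2 * (x ^ 2 / 2 + b * x) with hE2
  have hgap : x ≤ E2 - E1 := by
    -- E2 - E1 = x²/2 + (b - 7/2) x - (11/2 + b) ≥ x for x ≥ 2D + 2
    have h1 : (b - 7 / 2) * x ≥ -|b - 7 / 2| * x := by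
      nlinarith [neg_abs_le (b - 7 / 2), hx1]
    have h2' : -(11 / 2 + b) ≥ -|11 / 2 + b| * x := by
      nlinarith [le_abs_self (11 / 2 + b), hx1, abs_nonneg (11 / 2 + b)]
    have h3 : x ^ 2 / 2 ≥ (D + 1) * x := by nlinarith
    simp only [hE1, hE2, hD] at *
    nlinarith
  -- (1+ε₀)^{5(x+2)/2} ≤ 2^{5(x+2)/2}
  have hq : (1 + ε₀) ^ ((5 : ℝ) * (x + 2) / 2) ≤ (2 : ℝ) ^ ((5 : ℝ) * (x + 2) / 2) :=
    Real.rpow_le_rpow (by linarith) (by linarith) (by nlinarith)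
  -- LHS ≤ r C 2^{E1}
  have hL : (1 + ε₀) ^ ((5 : ℝ) * (k + 2) / 2) * r * w (k + 1) ≤ r * C * (2 : ℝ) ^ E1 := by
    have hsplit : (2 : ℝ) ^ E1 =
        (2 : ℝ) ^ ((5 : ℝ) * (x + 2) / 2) * (2 : ℝ) ^ ((x + 1) ^ 2 / 2 + b * (x + 1)) := by
      rw [hE1]; exact Real.rpow_add h2 _ _
    rw [hwk1, hsplit]
    have hw1 : 0 ≤ r * (C * (2 : ℝ) ^ ((x + 1) ^ 2 / 2 + b * (x + 1))) :=
      mul_nonneg hr (mul_nonneg hC.le (Real.rpow_pos_of_pos h2 _).le)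
    calc (1 + ε₀) ^ ((5 : ℝ) * (k + 2) / 2) * r * (C * (2 : ℝ) ^ ((x + 1) ^ 2 / 2 + b * (x + 1)))
        = (1 + ε₀) ^ ((5 : ℝ) * (x + 2) / 2) *
            (r * (C * (2 : ℝ) ^ ((x + 1) ^ 2 / 2 + b * (x + 1)))) := by rw [hxdef]; ring
      _ ≤ (2 : ℝ) ^ ((5 : ℝ) * (x + 2) / 2) *
            (r * (C * (2 : ℝ) ^ ((x + 1) ^ 2 / 2 + b * (x + 1)))) :=
          mul_le_mul_of_nonneg_right hq hw1
      _ = r * C * ((2 : ℝ) ^ ((5 : ℝ) * (x + 2) / 2) *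
            (2 : ℝ) ^ ((x + 1) ^ 2 / 2 + b * (x + 1))) := by ring
  -- RHS = ϑ C² 2^{E2}
  have hR : ϑ * w k ^ 2 = ϑ * C ^ 2 * (2 : ℝ) ^ E2 := by
    rw [hwk, hE2, mul_pow, ← Real.rpow_mul_natCast h2.le]
    push_cast
    ring_nf
  -- 2^{E1} ≤ 2^{E2} 2^{-x}
  have hE : (2 : ℝ) ^ E1 ≤ (2 : ℝ) ^ E2 * (2 : ℝ) ^ (-x) := by
    rw [← Real.rpow_add h2]
    exact Real.rpow_le_rpow_of_exponent_le (by norm_num) (by linarith)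
  -- 2^{-x} ≤ (1/2)^n
  have hsmall : (2 : ℝ) ^ (-x) ≤ (1 / 2 : ℝ) ^ n := by
    have h1 : (2 : ℝ) ^ (-x) ≤ (2 : ℝ) ^ (-(n : ℝ)) :=
      Real.rpow_le_rpow_of_exponent_le (by norm_num) (by
        have : (n : ℝ) ≤ x := by rw [hxdef]; exact_mod_cast hkn
        linarith)
    refine h1.trans (le_of_eq ?_)
    rw [Real.rpow_neg h2.le, Real.rpow_natCast, one_div, inv_pow]
  -- assemble: r C 2^{E1} ≤ r C 2^{E2} 2^{-x} ≤ C 2^{E2} · r (1/2)^n ≤ C 2^{E2} · ϑ C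
  have hE2pos : 0 < (2 : ℝ) ^ E2 := Real.rpow_pos_of_pos h2 _
  have hfin : r * (1 / 2 : ℝ) ^ n ≤ ϑ * C := by
    have h1 : r * (1 / 2 : ℝ) ^ n ≤ r * (ϑ * C / (r + 1)) :=
      mul_le_mul_of_nonneg_left hn.le hr
    have h2' : r * (ϑ * C / (r + 1)) ≤ ϑ * C := by
      rw [mul_div_assoc', div_le_iff₀ (by linarith)]
      nlinarith [mul_pos hϑ hC]
    linarith
  calc (1 + ε₀) ^ ((5 : ℝ) * (k + 2) / 2) * r * w (k + 1)
      ≤ r * C * (2 : ℝ) ^ E1 := hL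
    _ ≤ r * C * ((2 : ℝ) ^ E2 * (2 : ℝ) ^ (-x)) :=
        mul_le_mul_of_nonneg_left hE (mul_nonneg hr hC.le)
    _ ≤ r * C * ((2 : ℝ) ^ E2 * (1 / 2 : ℝ) ^ n) := by gcongr
    _ = C * (2 : ℝ) ^ E2 * (r * (1 / 2 : ℝ) ^ n) := by ring
    _ ≤ C * (2 : ℝ) ^ E2 * (ϑ * C) :=
        mul_le_mul_of_nonneg_left hfin (mul_nonneg hC.le hE2pos.le)
    _ = ϑ * C ^ 2 * (2 : ℝ) ^ E2 := by ring
    _ = ϑ * w k ^ 2 := hR.symm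

/-- **Gaussian weights satisfy the tree predicate `TailThin`** (appended once `TaoCascade.TailThin`
landed, p565233): `TailThin ε₀ w r` for `w k = C · 2^{k²/2 + b k}`, `C > 0`, `0 ≤ ε₀ ≤ 1`, `r ≥ 0`. [folklore] -/
theorem gaussian_weight_tailThin' {ε₀ r C b : ℝ} (hε : 0 ≤ ε₀) (hε1 : ε₀ ≤ 1) (hr : 0 ≤ r)
    (hC : 0 < C) (w : ℤ → ℝ) (hw : ∀ k : ℤ, w k = C * (2 : ℝ) ^ ((k : ℝ) ^ 2 / 2 + b * k)) :
    TailThin ε₀ w r :=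
  gaussian_weight_tailThin hε hε1 hr hC w hw

/-- **Shifted form of `TailThin`** (the form consumed by `…TailZone.pseudoFlowOn_tail_zone`): for every
`ϑ > 0` there is `k₂` with `(1+ε₀)^{5K/2} r w(K−1) ≤ ϑ (w(K−2))²` for all `K ≥ k₂`.
[cite: Tao2016AveragedNS, §6.2 Prop. 6.3 (ix) (statement shape); cell vocabulary, certificate format v2] -/
theorem tailThin_shifted {ε₀ : ℝ} {w : ℤ → ℝ} {r : ℝ} (h : TailThin ε₀ w r) {ϑ : ℝ} (hϑ : 0 < ϑ) :
    ∃ k₂ : ℤ, ∀ K : ℤ, k₂ ≤ K →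
      (1 + ε₀) ^ ((5 : ℝ) * K / 2) * r * w (K - 1) ≤ ϑ * w (K - 2) ^ 2 := by
  obtain ⟨k₀, hk₀⟩ := h ϑ hϑ
  refine ⟨k₀ + 2, fun K hK => ?_⟩
  have h1 := hk₀ (K - 2) (by linarith)
  have heq : (5 : ℝ) * (((K - 2 : ℤ) : ℝ) + 2) / 2 = (5 : ℝ) * K / 2 := by push_cast; ring
  have heq2 : K - 2 + 1 = K - 1 := by ring
  rw [heq, heq2] at h1
  exact h1

end GappedFrontRobust

end Summit.NavierStokesRegularity.NavierStokesRegularity.Theorems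

end
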